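import Mathlib
import Summits.Ventures.PercRepro.TriangleCapBelowGen

/-!
# PercRepro — THE EQUALITY LOCUS OF THE DIAGONAL AT SECOND ORDER, THE PIECES: at `Σ_v d(v)² + 2a (k − 2a − 1) = m k`
on the diagonal cell `(k, a, 0)` (`a ≥ 4`, `k ≥ 2a + 2`), every step of part 195's induction forces `D` to be
`(a + 1)`-bipartite (p3, gen 44; part 197a)

* the convexity is strict (`diag_convex_strict`: `k (k − 2a − 1) > 2a (k − 2a − 1)`);
* the cross-row deletion is strict off the boundary `k + d = 3a + 2` (`diag_cross_env_strict`,
  `diag_cross_cell_strict`) and tight on it only with `D − z` at the Mantel envelope and the neighbours of `z` at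
  `k − a − 2` (`diag_cross_cell_eq`): then `D − z = K_{a+1,k−a−2}` (the first-order locus `closed_form_eq_iff`) and
  the neighbours of `z` lie on its `(a + 1)`-side (their degree `k − a − 2` exceeds `a + 1` unless `k = 2a + 3`, where
  `nbhd_one_side_of_bipSub` decides the side) — `diag_cross_eq`;
* the within-row deletion of a vertex of degree `a` (`diag_within_eq`): `D − z = K_{a,k−1−a}` with the neighbours of
  `z` off the small side, or `D − z` at the second-best value of `k − 1` with the neighbours of `z` at `k − a − 2`
  (`diag_within_eq_gap`) — by the locus at `k − 1` (the induction hypothesis, a hypothesis here) `D − z` is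
  `(a + 1)`-bipartite with a missing star, and the neighbours of `z` lie on its `(a + 1)`-side.
Axioms: standard.
-/

namespace PercRepro

namespace TriangleCap

namespace C047

open Finset

variable {V : Type*} [Fintype V] [DecidableEq V]

/-- The envelope regime is strict: with `e ≥ 1` the slack `e (e + c + 2d)` is positive. -/
theorem diag_cross_env_strict (d c e m' S' T : ℕ) (he : 1 ≤ e)
    (hm' : m' + d = (d + c + e) * (d + c + e + 2 + c))
    (hS' : S' ≤ m' * (2 * (d + c + e) + 1 + c))
    (hT : T ≤ d * (d + c + e + c)) :
    S' + 2 * T + d + d * d + 2 * (d + c + e) * (c + 1) < (m' + d) * (2 * (d + c + e) + 2 + c) := by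
  nlinarith [hS', hT, Nat.mul_le_mul he (Nat.le_add_left 1 (c + 2 * d + e - 1)), Nat.zero_le ((2 * d + c + e) * e)]

/-- The closed-form regime is strict off the boundary: with `r' ≥ 1` the slack `2 (1 + b) r'` is positive. -/
theorem diag_cross_cell_strict (d b r' m' S' T : ℕ) (hr : 1 ≤ r')
    (hm' : m' + d = (d + 1 + b) * (d + 2 * b + 4 + r'))
    (hS' : S' + r' * (2 * d + 3 + 3 * b) ≤ m' * (2 * d + 3 * b + 4 + r'))
    (hT : T ≤ d * (d + 2 * b + 2 + r')) :
    S' + 2 * T + d + d * d + 2 * (d + 1 + b) * (b + 2 + r') < (m' + d) * (2 * d + 3 * b + 5 + r') := by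
  nlinarith [hS', hT, Nat.mul_le_mul hr (le_refl (1 + b))]

/-- On the boundary `r' = 0` equality forces the two bounds to be tight. -/
theorem diag_cross_cell_eq (d b m' S' T : ℕ)
    (hm' : m' + d = (d + 1 + b) * (d + 2 * b + 4))
    (hS' : S' ≤ m' * (2 * d + 3 * b + 4)) (hT : T ≤ d * (d + 2 * b + 2))
    (heq : S' + 2 * T + d + d * d + 2 * (d + 1 + b) * (b + 2) = (m' + d) * (2 * d + 3 * b + 5)) :
    S' = m' * (2 * d + 3 * b + 4) ∧ T = d * (d + 2 * b + 2) := by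
  have h : S' + 2 * T = m' * (2 * d + 3 * b + 4) + 2 * (d * (d + 2 * b + 2)) := by nlinarith [heq, hm']
  omega

/-- The within-row gap case: equality forces `D − z` at the second-best value of `k − 1` and the neighbours of `z`
at the cap `k − a − 2`. -/
theorem diag_within_eq_gap (a c m' S' T : ℕ) (hm' : m' = a * (a + 1 + c))
    (hS' : S' + 2 * a * c ≤ m' * (2 * a + 1 + c)) (hT : T ≤ a * (a + c))
    (heq : S' + 2 * T + a + a * a + 2 * a * (c + 1) = (m' + a) * (2 * a + 2 + c)) :
    S' + 2 * a * c = m' * (2 * a + 1 + c) ∧ T = a * (a + c) := by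
  subst hm'
  have h : S' + 2 * a * c + 2 * T = a * (a + 1 + c) * (2 * a + 1 + c) + 2 * (a * (a + c)) := by nlinarith [heq]
  omega

omit [DecidableEq V] in
/-- **THE CONVEXITY IS STRICT AT SECOND ORDER:** every degree in `[a + 1, k − a − 1]`, `2a + 2 ≤ k` ⇒
`Σ_v d(v)² + 2a (k − 2a − 1) < m k`. -/
theorem diag_convex_strict (D : SimpleGraph V) [DecidableRel D.Adj] (a : ℕ) (hk : 2 * a + 2 ≤ Fintype.card V)
    (hm : D.edgeFinset.card = a * (Fintype.card V - a)) (hcap : ∀ v, deg D v + a + 1 ≤ Fintype.card V)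
    (hdeg : ∀ v, a + 1 ≤ deg D v) :
    ∑ v, deg D v * deg D v + 2 * a * (Fintype.card V - 2 * a - 1) < D.edgeFinset.card * Fintype.card V := by
  have h := diag_convex_gen D a (by omega) hm hcap hdeg
  have h2 : 2 * a * (Fintype.card V - 2 * a - 1) < Fintype.card V * (Fintype.card V - 2 * a - 1) :=
    Nat.mul_lt_mul_of_pos_right (by omega) (by omega)
  omega

/-- **THE BOUNDARY OF THE CROSS-ROW CASE:** with the envelope of `D − z` available below `k + d = 3a + 2` and the
closed form on the cell `(k − 1, a + 1, k + d − 3a − 2)` from it on, equality `Σ_v d(v)² + 2a (k − 2a − 1) = m k`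
forces `k + d = 3a + 2`, `D − z` at the envelope and the neighbours of `z` at `k − a − 2`. -/
theorem diag_cross_boundary (a d k m' S' T : ℕ) (hk : 2 * a + 2 ≤ k) (hz : d + 1 ≤ a)
    (hmd : m' + d = a * (k - a)) (hT : T ≤ d * (k - a - 2))
    (henv : k + d < 3 * a + 2 → S' ≤ m' * (k - 1))
    (hcell : 3 * a + 2 ≤ k + d →
      S' + (k + d - (3 * a + 2)) * (k - 1 - 1 - (k + d - (3 * a + 2))) ≤ m' * (k - 1))
    (heq : S' + 2 * T + d + d * d + 2 * a * (k - 2 * a - 1) = (m' + d) * k) :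
    k + d = 3 * a + 2 ∧ S' = m' * (k - 1) ∧ T = d * (k - a - 2) := by
  rcases Nat.lt_or_ge (k + d) (3 * a + 2) with hsmall | hlarge
  · exfalso
    have henv' := henv hsmall
    obtain ⟨c, hc⟩ : ∃ c, k = 2 * a + 2 + c := ⟨k - (2 * a + 2), by omega⟩
    obtain ⟨e, he⟩ : ∃ e, k + d + e = 3 * a + 2 := ⟨3 * a + 2 - (k + d), by omega⟩
    have he1 : 1 ≤ e := by omega
    obtain rfl : a = d + c + e := by omega
    subst hc
    have e1 : 2 * (d + c + e) + 2 + c - 1 = 2 * (d + c + e) + 1 + c := by omega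
    have e2 : 2 * (d + c + e) + 2 + c - (d + c + e) - 2 = d + c + e + c := by omega
    have e3 : 2 * (d + c + e) + 2 + c - 2 * (d + c + e) - 1 = c + 1 := by omega
    have e4 : 2 * (d + c + e) + 2 + c - (d + c + e) = d + c + e + 2 + c := by omega
    rw [e1] at henv'
    rw [e2] at hT
    rw [e4] at hmd
    rw [e3] at heq
    have := diag_cross_env_strict d c e m' S' T he1 hmd henv' hT
    omega
  · have hcell' := hcell hlarge
    obtain ⟨t, ht⟩ : ∃ t, k + d = 3 * a + 2 + t := ⟨k + d - (3 * a + 2), by omega⟩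
    obtain ⟨b, hb⟩ : ∃ b, a = d + 1 + b := ⟨a - (d + 1), by omega⟩
    subst hb
    obtain rfl : k = 2 * d + 3 * b + 5 + t := by omega
    have e0 : 2 * d + 3 * b + 5 + t - (d + 1 + b) = d + 2 * b + 4 + t := by omega
    have e1 : 2 * d + 3 * b + 5 + t + d - (3 * (d + 1 + b) + 2) = t := by omega
    have e2 : 2 * d + 3 * b + 5 + t - 1 - 1 - t = 2 * d + 3 + 3 * b := by omega
    have e3 : 2 * d + 3 * b + 5 + t - 1 = 2 * d + 3 * b + 4 + t := by omega
    have e4 : 2 * d + 3 * b + 5 + t - (d + 1 + b) - 2 = d + 2 * b + 2 + t := by omega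
    have e5 : 2 * d + 3 * b + 5 + t - 2 * (d + 1 + b) - 1 = b + 2 + t := by omega
    rw [e0] at hmd
    rw [e1, e2, e3] at hcell'
    rw [e4] at hT
    rw [e5] at heq
    rcases Nat.eq_zero_or_pos t with ht0 | ht1
    · subst ht0
      simp only [zero_mul, add_zero] at hcell' hT heq
      obtain ⟨h1, h2⟩ := diag_cross_cell_eq d b m' S' T hmd hcell' hT heq
      refine ⟨by omega, ?_, ?_⟩
      · rw [e3]; exact h1
      · rw [e4]; exact h2
    · exfalso
      have := diag_cross_cell_strict d b t m' S' T ht1 hmd hcell' hT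
      omega

/-- On the boundary `k + d = 3a + 2` the edge count of `D − z` is that of `K_{a+1,k−a−2}`. -/
theorem diag_cross_eq_edges (a d k m' : ℕ) (hkd : k + d = 3 * a + 2) (hz : d + 1 ≤ a)
    (hmd : m' + d = a * (k - a)) :
    m' + (a + 1) * (a + 1) + 0 = (a + 1) * (k - 1) ∧ m' + 0 = (a + 1) * (k - 1 - (a + 1)) := by
  obtain ⟨b, hb⟩ : ∃ b, a = d + 1 + b := ⟨a - (d + 1), by omega⟩
  subst hb
  obtain rfl : k = 2 * d + 3 * b + 5 := by omega
  have e0 : 2 * d + 3 * b + 5 - (d + 1 + b) = d + 2 * b + 4 := by omega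
  have e1 : 2 * d + 3 * b + 5 - 1 = 2 * d + 3 * b + 4 := by omega
  have e2 : 2 * d + 3 * b + 4 - (d + 1 + b + 1) = d + 2 * b + 2 := by omega
  rw [e0] at hmd
  rw [e1, e2]
  constructor <;> nlinarith [hmd]

/-- **THE CROSS-ROW CASE AT EQUALITY, THE STRUCTURE:** on the boundary `k + d = 3a + 2`, `D − z` at the envelope
with every neighbour of `z` at `k − a − 2` ⇒ `D` is a spanning subgraph of some `K(A, Aᶜ)`, `|A| = a + 1`. -/
theorem diag_cross_structure (D : SimpleGraph V) [DecidableRel D.Adj] (hK : K4mFree D) (a : ℕ) (ha : 4 ≤ a)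
    (z : V) (hkd : Fintype.card V + deg D z = 3 * a + 2)
    (hz : deg D z + 1 ≤ a)
    (hmd : (del D z).edgeFinset.card + deg D z = a * (Fintype.card V - a))
    (hS'eq : ∑ w : {v : V // v ≠ z}, deg (del D z) w * deg (del D z) w =
      (del D z).edgeFinset.card * Fintype.card {v : V // v ≠ z})
    (hdeg : ∀ w : {v : V // v ≠ z}, D.Adj w.1 z → deg (del D z) w = Fintype.card V - a - 2) :
    ∃ A : Finset V, A.card = a + 1 ∧ BipSub D A := by
  have hK' := k4mFree_del D hK z
  have hcard' := card_del z
  obtain ⟨k, hk'⟩ : ∃ k, Fintype.card V = k := ⟨_, rfl⟩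
  have hk'' : Fintype.card {v : V // v ≠ z} = k - 1 := by omega
  obtain ⟨d, hd⟩ : ∃ d, deg D z = d := ⟨_, rfl⟩
  obtain ⟨m', hm'def⟩ : ∃ m', (del D z).edgeFinset.card = m' := ⟨_, rfl⟩
  rw [hk'] at hkd hmd hdeg
  rw [hd] at hkd hz hmd
  rw [hm'def] at hmd
  obtain ⟨he1, he2⟩ := diag_cross_eq_edges a d k m' hkd hz hmd
  -- `D − z` is `K_{a+1,k−a−2}`
  obtain ⟨A', -, hA'card, hA', -⟩ := (closed_form_eq_iff (del D z) hK' (a + 1) 0 (by omega)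
    (by rw [hk'']; omega) (by rw [hk'']; omega) (by rw [hm'def, hk'']; exact he1)).mp (by
      rw [hS'eq]
      simp only [zero_mul, add_zero])
  rcases Nat.lt_or_ge (2 * a + 3) k with hk4 | hk3
  · -- `k ≥ 2a + 4`: a vertex off `A'` has degree `≤ a + 1 < k − a − 2`
    have hin : ∀ w : {v : V // v ≠ z}, D.Adj w.1 z → w ∈ A' := by
      intro w hw
      by_contra hwA
      have h1 := deg_le_card_of_bipSub (del D z) A' hA' w hwA
      have h2 := hdeg w hw
      omega
    obtain ⟨B, hBcard, hB⟩ := bipSub_lift D z A' hA' hin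
    exact ⟨B, by rw [hBcard, hA'card], hB⟩
  · -- `k = 2a + 3`, `d = a − 1 ≥ 3`: the neighbours of `z` lie on one side, both of size `a + 1`
    have hm'0 : (del D z).edgeFinset.card + 0 = (a + 1) * (Fintype.card {v : V // v ≠ z} - (a + 1)) := by
      rw [hm'def, hk'']; exact he2
    rcases nbhd_one_side_of_bipSub D hK z A' (a + 1) 0 hA'card hA' hm'0 (by omega) with hin | hoff
    · obtain ⟨B, hBcard, hB⟩ := bipSub_lift D z A' hA' hin
      exact ⟨B, by rw [hBcard, hA'card], hB⟩
    · have hA'c : BipSub (del D z) A'ᶜ := bipSub_compl (del D z) A' hA'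
      have hoff' : ∀ w : {v : V // v ≠ z}, D.Adj w.1 z → w ∈ A'ᶜ := fun w hw => mem_compl.mpr (hoff w hw)
      obtain ⟨B, hBcard, hB⟩ := bipSub_lift D z A'ᶜ hA'c hoff'
      refine ⟨B, ?_, hB⟩
      rw [hBcard, card_compl, hA'card, hk'']
      omega

/-- **THE CROSS-ROW CASE AT EQUALITY:** `m = a (k − a)`, `4 ≤ a`, `2a + 2 ≤ k`, every degree `≤ k − a − 1`, a vertex `z`
of degree `≤ a − 1`, `Σ_v d(v)² + 2a (k − 2a − 1) = m k` ⇒ `D` is a spanning subgraph of some `K(A, Aᶜ)` with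
`|A| = a + 1`. -/
theorem diag_cross_eq (D : SimpleGraph V) [DecidableRel D.Adj] (hK : K4mFree D) (a : ℕ) (ha : 4 ≤ a)
    (hk : 2 * a + 2 ≤ Fintype.card V) (hm : D.edgeFinset.card = a * (Fintype.card V - a))
    (hcap : ∀ v, deg D v + a + 1 ≤ Fintype.card V) (z : V) (hz : deg D z + 1 ≤ a)
    (heq : ∑ v, deg D v * deg D v + 2 * a * (Fintype.card V - 2 * a - 1) = D.edgeFinset.card * Fintype.card V) :
    ∃ A : Finset V, A.card = a + 1 ∧ BipSub D A := by
  have hK' := k4mFree_del D hK z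
  have hcard' := card_del z
  have hedges' := card_edges_del D z
  have hsq := sum_deg_sq_del D z
  have hT := sum_del_nbhd_le D z (Fintype.card V - a - 2) (fun v => by have := hcap v; omega)
  have hmd : (del D z).edgeFinset.card + deg D z = a * (Fintype.card V - a) := by rw [hedges', hm]
  obtain ⟨T, hTdef⟩ : ∃ T, ∑ w : {v : V // v ≠ z}, (if D.Adj w.1 z then deg (del D z) w else 0) = T := ⟨_, rfl⟩
  obtain ⟨S', hS'def⟩ : ∃ S', ∑ w : {v : V // v ≠ z}, deg (del D z) w * deg (del D z) w = S' := ⟨_, rfl⟩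
  obtain ⟨m', hm'def⟩ : ∃ m', (del D z).edgeFinset.card = m' := ⟨_, rfl⟩
  obtain ⟨d, hd⟩ : ∃ d, deg D z = d := ⟨_, rfl⟩
  obtain ⟨k, hk'⟩ : ∃ k, Fintype.card V = k := ⟨_, rfl⟩
  have hk'' : Fintype.card {v : V // v ≠ z} = k - 1 := by omega
  have henv : k + d < 3 * a + 2 → S' ≤ m' * (k - 1) := fun _ => by
    have h := sum_deg_sq_le_of_k4mFree (del D z) hK' (by omega)
    rw [hS'def, hm'def, hk''] at h
    exact h
  have hcell : 3 * a + 2 ≤ k + d →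
      S' + (k + d - (3 * a + 2)) * (k - 1 - 1 - (k + d - (3 * a + 2))) ≤ m' * (k - 1) := fun hl => by
    obtain ⟨hc2, hc3⟩ := below_cross_cell_side a 0 d k m' (by omega) (by omega)
      (by rw [← hm'def, ← hd, ← hk']; simpa using hmd)
    rw [← hk''] at hc2 hc3
    rw [← hm'def] at hc3
    have h := closed_form_stability (del D z) hK' (a + 1) (k + 0 + d - (3 * a + 2)) (by omega) hc2 hc3
    rw [hS'def, hm'def, hk''] at h
    simpa using h
  rw [hd] at hz hedges' hsq hT hmd
  rw [hTdef] at hsq hT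
  rw [hS'def] at hsq
  rw [hm'def] at hedges' hmd
  rw [hk'] at hk hm hT heq hmd
  rw [hsq, ← hedges'] at heq
  obtain ⟨hkd, hS'eq, hTeq'⟩ := diag_cross_boundary a d k m' S' T hk hz hmd hT henv hcell heq
  have hTeq := deg_del_eq_of_sum_eq D z (Fintype.card V - a - 2) (fun v => by have := hcap v; omega)
    (by rw [hTdef, hd, hk', hTeq'])
  apply diag_cross_structure D hK a ha z (by omega) (by omega) (by rw [← hm'def, ← hd] at hmd; rw [hk']; exact hmd)
  · rw [hS'def, hm'def, hk'']; exact hS'eq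
  · intro w hw; exact hTeq w hw

end C047

end TriangleCap

end PercRepro
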